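import Summits.CriticalPhenomena.PercolationContinuityZ3.Theorems.Transplant.SkelPhiCellsWeakGT
import Summits.CriticalPhenomena.PercolationContinuityZ3.Theorems.Transplant.SkelPhiCellsWeakGLevels
import HarnessLib

/-!
(R-40) SUCCESSOR `…T` (hp-8 g42, 2026-08-23; ruling p3-g16 06:23:56Z, J18): the twin of `SkelPhiCellsWeakGLevelsS` over the PER-AXIS creep cap `PCells2T` (PlanarCells2TDefs:
`c i ≤ r (oth i)` instead of the uniform `c i ≤ cmax ≤ r j`); statements and proofs VERBATIM with `PCells2S ↦ PCells2T` (+ the renames of record of the T layer below it);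
the only mathematical touch points are the places that read the cap, which only ever need the cross form `c (oth j) ≤ r j` (listed in the lane line of this file's landing).
NO landed file is edited; `SkelPhiCellsWeakGLevelsS` stays valid (and is an instance of this file through `PCells2S.toT`). NON-VACUITY: inherited verbatim from `SkelPhiCellsWeakGLevelsS` (same witness line).

# N2 (frames-only node `SamePDropOfSkeletonFrm₁`, OPEN), WAVE-1 Geom re-base, part 2: `ExitGeom`, `StepsGeom`, `LevelGeom`, `QSepGeom` for the record
# `Skelφ.cellGeomSG₂T` over STAGGERED cells (`PCells2T`), with the face / level data `faceDataSGT`, `levelDataST` — the `PCells2T` twin of hp-8 g33's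
# `SkelPhiCellsWeakGLevels` (companion of `SkelPhiCellsWeakGS`)

builds on p205010 (kernel theorem, internal audit signed; external expert review pending) — nothing in this file uses p205010; nothing here is a
claim about the open node `SamePDropOfSkeletonFrm₁` (`SamePDropOfSkeletonNeg₁` is CLOSED in the tree and untouched by this file).
Lane `prim-bschramm`, seat `prim-hp-8` (gen 40); helper file (`--supports stmt-CriticalPhenomena-4575 --as helper`); design owner p3-g15 ((R-22)/(R-27)/(R-29), J5).
WHAT CHANGES against `SkelPhiCellsWeakGLevels` (everything else is its text over `PCells2T`, boxes about `cenS`):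
(1) `faceDataSGT` / `levelDataST`: the face and corridor spans and the staircase levels read at the level about `cenS` (profile `profT`);
(2) the far region is the slack two-block `FarNS₂` of `cellGeomSG₂T`: `StepsGeom.Hfull_subset` steps UP into it by `upBox_subset_FarNS₂`, `mem_VWin_FarNS₂_of_adjT`
    reads `lev_le_of_mem_Hfull_not_FarNS₂'`, `M ⊆ FarNS₂` is `M_add_stepVec_subset_FarNS₂`, and the three separations go through `FarNS₂ ⊆ FarNS`;
(3) J5 (design owner 2026-08-22T21:21:47Z): the `rev` identity `BtwN_rev'` is FALSE under the stagger, so `Btw_sep_Efar` is the direct two-box separation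
    `BtwNS_sepInf_FarNS_add` of `PlanarCells2SepInfS`;
(4) `ExitGeom.locFin` under the stagger: a neighbour of `y` in `E_{w,δ}` pins BOTH coordinates of the staggered centre `cenS (w+δ)` (`sub_cenS_le_of_mem_EwvNS`),
    and the 2D separation `PCells2S.abs_gap_ge` (the coordinate with the larger macro-index wins, `c ≤ r`) turns that into a bound on the macro-vertex.
* §4 `faceDataSGT`, `levelDataST`, `lev_le_lev_add_one_of_adjT`, `mem_VStair_Stub_of_adjT`;
* §5 `exitGeomSG₂T (hlip)`, **`stepsGeomSG₂T (hlip) (hws)`**; §6 `mem_VWin_FarNS₂_of_adjT`, **`levelGeomSG₂T (hlip)`**, `qSepGeomSG₂T (hlip)`.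
[cite: KozmaNitzan2024, §4 pp. 26–27, 30–31 (E_{v,x}, H^j_{v,x}, F^j_{v,x}, Step IV)] [cite: MartineauTassion2017, §4.3]
-/

noncomputable section

open scoped Classical

namespace Summit.CriticalPhenomena.PercolationContinuityZ3.Theorems

namespace Transplant

namespace Skelφ

open Literature.Probability.Percolation Literature.Probability.LatticeModels SimpleGraph KNCells
open Literature.Probability.Percolation.KozmaNitzan
open Literature.Probability.Percolation.KozmaNitzan.Cells (oth oth_ne sgOf sgOf_sign stepVec_apply_fst stepVec_apply_oth eq_oth_of_ne oth_oth)
open Literature.Barriers.CriticalPhenomena (graphBall graphBall_finite mem_graphBall_self graphBall_mono)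
open BoxProdZ2 (ConcRadiiG)
open PlanarSkeletonConc (mem_vspan_edgesIn_iff mem_vspan_edgesIn_of_adj)

variable {V : Type} [DecidableEq V] {G : SimpleGraph V} [G.LocallyFinite] {ψ : V → Site 2}

/-! ## §4 Face data and staircase levels about the staggered centre -/

variable (G ψ) in
/-- **Face data over staggered cells**: `F^j` = the face row (planar level `5r∥ + 10 s∥ j − 1` about `cenS`) of the stub staircase, `H` = the corridor
staircase (twin of `faceDataSG`). [cite: KozmaNitzan2024, §4 p. 30 (F^j_{v,x})] -/
def faceDataSGT (P : PCells2T) (w₀ : V) (Λ : ConcRadiiG) : FaceData V ℕ where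
  Face := fun a v δ j => (VStair G ψ w₀ (PCells2T.Stub P v δ j) (profT P Λ a v δ)).filter fun y =>
    PCells2T.lev P δ v (ψ y) = 5 * (P.r δ.1 : ℤ) + 10 * (P.s δ.1 : ℤ) * j - 1
  Hfull := fun a v δ => VStair G ψ w₀ (PCells2T.Hfull P v δ) (profT P Λ a v δ)

variable (ψ) in
/-- **Level data over staggered cells** — the STAIRCASE levels of the planar level about `cenS`: `lev = stairLev δ.1 (lev)`, `L j = 2j`, `ℓQ = 1`
(twin of `levelDataS`). [this work] -/
def levelDataST (P : PCells2T) : LevelData V ℕ where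
  lev := fun _ v δ y => P.stairLev δ.1 (PCells2T.lev P δ v (ψ y))
  L := fun j => 2 * (j : ℤ)
  ℓQ := 1

omit [DecidableEq V] [G.LocallyFinite] in
/-- Under (lip) the planar level about `cenS` drops by at most one along an edge. [folklore] -/
theorem lev_le_lev_add_one_of_adjT (hlip : Lip G ψ) (P : PCells2T) {δ : MDir} (v : Site 2) {y z : V} (h : G.Adj y z) :
    PCells2T.lev P δ v (ψ z) ≤ PCells2T.lev P δ v (ψ y) + 1 :=
  P.lev_le_lev_add_one_of_abs_sub_le_one v (by rw [abs_sub_comm]; exact hlip h δ.1)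

/-- An inside edge of the corridor staircase starting at planar level `≤ 5r∥ + 10s∥j − 1` (about `cenS`) is an inside edge of the stub staircase `H^j`.
[this work] -/
theorem mem_VStair_Stub_of_adjT (hlip : Lip G ψ) {P : PCells2T} {w₀ : V} {ρ : Site 2 → ℕ} {v : Site 2} {δ : MDir} {j : ℕ} {y z : V}
    (hy : y ∈ stair G ψ w₀ (PCells2T.Hfull P v δ) ρ) (hz : z ∈ stair G ψ w₀ (PCells2T.Hfull P v δ) ρ) (hadj : G.Adj y z)
    (hl : PCells2T.lev P δ v (ψ y) ≤ 5 * (P.r δ.1 : ℤ) + 10 * (P.s δ.1 : ℤ) * j - 1) : y ∈ VStair G ψ w₀ (PCells2T.Stub P v δ j) ρ := by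
  rw [mem_stair] at hy hz
  have hlz : P.lev δ v (ψ z) ≤ 5 * P.r δ.1 + 10 * P.s δ.1 * j := by
    have := lev_le_lev_add_one_of_adjT hlip P v hadj (δ := δ); omega
  refine (mem_vspan_edgesIn_of_adj ?_ ?_ hadj).1
  · exact mem_stair.2 ⟨P.mem_Stub_of_mem_Hfull hy.1 (by omega), hy.2⟩
  · exact mem_stair.2 ⟨P.mem_Stub_of_mem_Hfull hz.1 hlz, hz.2⟩

section Records

variable (P : PCells2T) (w₀ : V) {Λ : ConcRadiiG} (hΛ : WFS2 P.toPCells2 Λ)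

/-! ## §5 `ExitGeom`, `StepsGeom` -/

include hΛ in
/-- **`ExitGeom`** over staggered cells (`locFin` from (lip): a neighbour of `y` inside `E_{w,δ}` pins the staggered centre of `w + δ` within
`35 r_i + 1` of `ψ y i` in both coordinates, hence the macro-vertex by the 2D separation of staggered centres). [cite: KozmaNitzan2024, §4 pp. 26–27] -/
theorem exitGeomSG₂T (hlip : Lip G ψ) : ExitGeom G (cellGeomSG₂T G ψ P w₀ Λ) where
  M_subset_Q a v := VWin_mono (P.M_subset_Q v) (let h := hΛ.rM_le_rE_le_rQ a v; h.1.trans h.2)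
  Cell_disjoint_Q a a' u x hux := disjoint_VWin (P.Cell_disjoint_Q hux) _ _
  Zone_disjoint_Q a a' u δ x := disjoint_VWin (P.Zone_disjoint_Q u δ x) _ _
  locFin y := by
    set A : ℤ := |ψ y 0| + |ψ y 1| + 35 * ((P.r 0 : ℤ) + P.r 1) + 3 with hA
    set B : Site 2 := fun _ => A with hB
    refine (Finset.Icc (-B) B).finite_toSet.subset ?_
    rintro v ⟨a, w, δ, rfl, b, hb, hadj⟩
    change b ∈ VWin G ψ w₀ (P.BtwNS w δ) (Λ.rB a w δ) ∪ VWin G ψ w₀ (P.Q (w + stepVec δ)) (Λ.rQ a (w + stepVec δ)) at hb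
    have hb2 : ψ b ∈ P.EwvNS w δ := by
      rw [PCells2T.EwvNS, Finset.mem_union]
      rcases Finset.mem_union.1 hb with h | h
      · exact Or.inl (φ_mem_of_mem_VWin h)
      · exact Or.inr (φ_mem_of_mem_VWin h)
    have hnear : ∀ i, |ψ b i - ψ y i| ≤ 1 := fun i => by
      rw [abs_sub_comm]; exact hlip hadj i
    -- both coordinates of the staggered centre of `x := w + δ` are pinned
    set x : Site 2 := w + stepVec δ with hx
    have hK : ∀ i, |P.cenS x i| ≤ |ψ y i| + 35 * P.r i + 1 := fun i => by
      have h1 := P.sub_cenS_le_of_mem_EwvNS hb2 i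
      have h2 := hnear i
      rw [abs_le] at h1 h2 ⊢
      have hy' := le_abs_self (ψ y i)
      have hy'' := neg_abs_le (ψ y i)
      constructor <;> linarith
    have h01 : oth (0 : Fin 2) = 1 := by decide
    have h10 : oth (1 : Fin 2) = 0 := by decide
    have e0 : P.cenS x 0 = 20 * (P.r 0 : ℤ) * x 0 + P.c 1 * x 1 := by rw [PCells2T.cenS_apply, h01]
    have e1 : P.cenS x 1 = 20 * (P.r 1 : ℤ) * x 1 + P.c 0 * x 0 := by rw [PCells2T.cenS_apply, h10]
    have hr0 : (1 : ℤ) ≤ P.r 0 := by exact_mod_cast P.one_le_r 0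
    have hr1 : (1 : ℤ) ≤ P.r 1 := by exact_mod_cast P.one_le_r 1
    -- the 2D separation: the coordinate with the larger macro-index is read off its own centre coordinate
    have hx : ∀ i, |x i| ≤ A - 1 := by
      have hK0 := hK 0; have hK1 := hK 1
      rw [e0] at hK0; rw [e1] at hK1
      have ha0 := abs_nonneg (ψ y 0); have ha1 := abs_nonneg (ψ y 1)
      have hc10 : P.c 1 ≤ (P.r 0 : ℤ) := by
        have h := P.hcr 1; have e : oth (1 : Fin 2) = 0 := by decide
        rw [e] at h; exact h
      have hc01 : P.c 0 ≤ (P.r 1 : ℤ) := by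
        have h := P.hcr 0; have e : oth (0 : Fin 2) = 1 := by decide
        rw [e] at h; exact h
      rcases le_total |x 1| |x 0| with hle | hle
      · have g := PCells2S.abs_gap_ge (P.c_nonneg 1) hc10 hle
        have hx0 : |x 0| ≤ A - 1 := by nlinarith [abs_nonneg (x 0)]
        intro i; fin_cases i
        · exact hx0
        · exact hle.trans hx0
      · have g := PCells2S.abs_gap_ge (P.c_nonneg 0) hc01 hle
        have hx1 : |x 1| ≤ A - 1 := by nlinarith [abs_nonneg (x 1)]
        intro i; fin_cases i
        · exact hle.trans hx1
        · exact hx1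
    rw [Finset.coe_Icc, Set.mem_Icc]
    have key : ∀ i, |x i| ≤ B i := fun i => by
      have := hx i; simp only [hB]; omega
    exact ⟨fun i => (abs_le.1 (key i)).1, fun i => (abs_le.1 (key i)).2⟩

include hΛ in
/-- **`StepsGeom`** over staggered cells (faces ⊆ stubs ⊆ corridor; corridor ⊆ `Q_a ∪ FarNS₂` by a WEAK step into a slack box — down into the cube from the
base rows, up into the two-block far region above them; target cube ⊆ far region), under (lip) and weak steps. [cite: KozmaNitzan2024, §4 pp. 26, 30] -/
theorem stepsGeomSG₂T (hlip : Lip G ψ) (hws : WeakSteps G ψ) : StepsGeom (cellGeomSG₂T G ψ P w₀ Λ) (faceDataSGT G ψ P w₀ Λ) where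
  Face_subset_Stub _ _ _ _ := Finset.filter_subset _ _
  Stub_subset_Hfull a v δ j hj := VStair_mono (P.Stub_subset_Hfull v δ (by change j ≤ P.K at hj; exact hj)) fun _ _ => le_rfl
  Hfull_subset a a' v δ ha' := by
    intro y hy
    change y ∈ VStair G ψ w₀ (P.Hfull v δ) (profT P Λ a' v δ) at hy
    change y ∈ VWin G ψ w₀ (P.Q v) (Λ.rQ a v) ∪ VWin G ψ w₀ (P.FarNS₂ v δ) (Λ.rE a' v δ)
    obtain ⟨hP, hd⟩ := mem_of_mem_VStair hy
    obtain ⟨htr, hl, hu⟩ := P.bounds_of_mem_Hfull hP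
    have hr : (1 : ℤ) ≤ P.r δ.1 := by exact_mod_cast P.one_le_r δ.1
    have hr1 : (1 : ℤ) ≤ P.r (oth δ.1) := by exact_mod_cast P.one_le_r (oth δ.1)
    by_cases hlev : P.lev δ v (ψ y) ≤ 5 * P.r δ.1
    · -- base rows: down-step into the cube
      obtain ⟨m, hadj, h1, h2, h3⟩ := exists_adj_downBoxT hlip hws P δ v y
      have hyQ : ψ y ∈ P.Q v := P.downBox_subset_Q (htr.trans (by omega)) (by omega) hlev le_rfl (by omega) (by simp)
      have hmQ : ψ m ∈ P.Q v := P.downBox_subset_Q (htr.trans (by omega)) (by omega) hlev h1 h2 h3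
      exact Finset.mem_union_left _ (mem_VWin_of_adj hd (hΛ.ρQ1 a a' v δ _ ha' hlev) hyQ hadj hmQ)
    · -- above the base rows: up-step into the slack two-block far region
      obtain ⟨m, hadj, h1, h2, h3⟩ := exists_adj_upBoxT hlip hws P δ v y
      have hyE : ψ y ∈ P.FarNS₂ v δ := P.upBox_subset_FarNS₂ htr (by omega) (by omega) le_rfl (by omega) (by simp)
      have hmE : ψ m ∈ P.FarNS₂ v δ := P.upBox_subset_FarNS₂ htr (by omega) (by omega) h1 h2 h3
      exact Finset.mem_union_right _ (mem_VWin_of_adj hd (hΛ.ρE1 a' v δ _) hyE hadj hmE)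
  M_tgt_subset_Efar a v δ := VWin_mono (P.M_add_stepVec_subset_FarNS₂ v δ) (hΛ.ME a v δ)

/-! ## §6 `LevelGeom` (staircase levels, the two-block far region) and `QSepGeom` -/

/-- An inside edge of a staircase over `H` (or a subset) starting at planar level `≥ 5r∥ + 2` about `cenS` is an inside edge of the window over
`FarNS₂` (profile `≤ rE`). [this work] -/
theorem mem_VWin_FarNS₂_of_adjT (hlip : Lip G ψ) {P : PCells2T} {w₀ : V} {Λ : ConcRadiiG} (hW : WF2 P.toPCells2 Λ) {a : ℕ} {v : Site 2}
    {δ : MDir} {Pl : Finset (Site 2)} (hPH : Pl ⊆ PCells2T.Hfull P v δ) {y z : V} (hy : y ∈ stair G ψ w₀ Pl (profT P Λ a v δ))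
    (hz : z ∈ stair G ψ w₀ Pl (profT P Λ a v δ)) (hadj : G.Adj y z) (hl : 5 * (P.r δ.1 : ℤ) + 2 ≤ PCells2T.lev P δ v (ψ y)) :
    y ∈ VWin G ψ w₀ (PCells2T.FarNS₂ P v δ) (Λ.rE a v δ) := by
  rw [mem_stair] at hy hz
  have hlz : 5 * (P.r δ.1 : ℤ) + 1 ≤ P.lev δ v (ψ z) := by
    have := lev_le_lev_add_one_of_adjT hlip P v hadj.symm (δ := δ); omega
  have hyE : ψ y ∈ P.FarNS₂ v δ := by
    by_contra hn; have := P.lev_le_of_mem_Hfull_not_FarNS₂' (hPH hy.1) hn; omega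
  have hzE : ψ z ∈ P.FarNS₂ v δ := by
    by_contra hn; have := P.lev_le_of_mem_Hfull_not_FarNS₂' (hPH hz.1) hn; omega
  refine (mem_vspan_edgesIn_of_adj ?_ ?_ hadj).1
  · exact (mem_Win G ψ).2 ⟨graphBall_mono G w₀ (hW.ρE a v δ _) hy.2, hyE⟩
  · exact (mem_Win G ψ).2 ⟨graphBall_mono G w₀ (hW.ρE a v δ _) hz.2, hzE⟩

include hΛ in
/-- **`LevelGeom`** over staggered cells with the two-unit narrow arm, the two-block far region, the level shift and the STAIRCASE levels; `Btw_sep_Efar`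
is the two-box separation `BtwNS_sepInf_FarNS_add` (J5). [cite: KozmaNitzan2024, §4 p. 31 (Step IV)] -/
theorem levelGeomSG₂T (hlip : Lip G ψ) : LevelGeom G (cellGeomSG₂T G ψ P w₀ Λ) (faceDataSGT G ψ P w₀ Λ) (levelDataST ψ P) where
  adj_le a' v δ y z h := by
    change P.stairLev δ.1 (P.lev δ v (ψ z)) ≤ P.stairLev δ.1 (P.lev δ v (ψ y)) + 1
    exact P.stairLev_le_add_one δ.1 (lev_le_lev_add_one_of_adjT hlip P v h)
  lev_Q a a' v δ _ y hy := by
    change P.stairLev δ.1 (P.lev δ v (ψ y)) ≤ 1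
    refine P.stairLev_le_one_of_le δ.1 ?_
    have := P.lev_le_of_mem_Q (δ := δ) (φ_mem_of_mem_VWin hy); omega
  lev_Hfull a' v δ y hy hn := by
    change P.stairLev δ.1 (P.lev δ v (ψ y)) ≤ 1
    change y ∉ VWin G ψ w₀ (P.FarNS₂ v δ) (Λ.rE a' v δ) at hn
    by_contra hlt
    have h2 := P.base_add_two_le_of_two_le_stairLev δ.1 (show (2 : ℤ) ≤ P.stairLev δ.1 (P.lev δ v (ψ y)) by omega)
    obtain ⟨hyS, z, hz, hadj⟩ := mem_vspan_edgesIn_iff.1 hy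
    exact hn (mem_VWin_FarNS₂_of_adjT hlip hΛ.toWF2 subset_rfl hyS hz hadj h2)
  ℓQ_lt j hj := by
    change (1 : ℤ) < 2 * (j : ℤ)
    have : (1 : ℤ) ≤ j := by exact_mod_cast hj
    omega
  mem_Stub a' v δ j _ _ y hy hl := by
    change P.stairLev δ.1 (P.lev δ v (ψ y)) ≤ 2 * (j : ℤ) at hl
    obtain ⟨hyS, z, hz, hadj⟩ := mem_vspan_edgesIn_iff.1 hy
    exact mem_VStair_Stub_of_adjT hlip hyS hz hadj (P.le_faceRow_of_stairLev_le δ.1 hl)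
  mem_Face a' v δ j _ _ y hy hl := by
    change P.stairLev δ.1 (P.lev δ v (ψ y)) = 2 * (j : ℤ) at hl
    have hl' := P.eq_faceRow_of_stairLev_eq δ.1 hl
    obtain ⟨hyS, z, hz, hadj⟩ := mem_vspan_edgesIn_iff.1 hy
    exact Finset.mem_filter.2 ⟨mem_VStair_Stub_of_adjT hlip hyS hz hadj hl'.le, hl'⟩
  Face_far a' v δ j hjK t ht := by
    obtain ⟨htS, hl⟩ := Finset.mem_filter.1 ht
    have hs1 : (1 : ℤ) ≤ P.s δ.1 := by exact_mod_cast P.hs δ.1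
    refine ⟨?_, ?_⟩
    · change t ∈ VWin G ψ w₀ (P.FarNS₂ v δ) (Λ.rE a' v δ)
      obtain ⟨htS', z, hz, hadj⟩ := mem_vspan_edgesIn_iff.1 htS
      refine mem_VWin_FarNS₂_of_adjT hlip hΛ.toWF2 (P.Stub_subset_Hfull v δ hjK) htS' hz hadj ?_
      rw [hl]; push_cast; nlinarith
    · change 2 * (j : ℤ) + 1 ≤ P.stairLev δ.1 (P.lev δ v (ψ t))
      rw [hl, P.stairLev_faceRow δ.1 (j + 1)]; push_cast; omega
  M_far a' v δ t ht := by
    have hl := P.lev_ge_of_mem_M_add (δ := δ) (φ_mem_of_mem_VWin ht)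
    have hrK : (P.r δ.1 : ℤ) = P.K * P.s δ.1 := P.r_eq δ.1
    refine ⟨VWin_mono (P.M_add_stepVec_subset_FarNS₂ v δ) (hΛ.ME a' v δ) ht, ?_⟩
    change 2 * ((P.K : ℕ) : ℤ) + 1 ≤ P.stairLev δ.1 (P.lev δ v (ψ t))
    refine P.stairLev_ge_of_face_le δ.1 ?_
    nlinarith
  Btw_sep_Efar a a' w δw du hdu := by
    change KNCells.Sep G (VWin G ψ w₀ (P.BtwNS w δw) (Λ.rB a w δw)) (VWin G ψ w₀ (P.FarNS₂ (w + stepVec δw) du) (Λ.rE a' (w + stepVec δw) du))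
    exact sep_VWin_of_sepInf hlip ((P.BtwNS_sepInf_FarNS_add w hdu).mono subset_rfl (Finset.coe_subset.2 (P.FarNS₂_subset_FarNS _ _))) _ _
  Cell_sep_Efar b a' u v δ huv hux :=
    sep_VWin_of_sepInf hlip ((P.Cell_sepInf_FarNS huv hux).mono subset_rfl (Finset.coe_subset.2 (P.FarNS₂_subset_FarNS _ _))) _ _
  Zone_sep_Efar b a' u δ' v δ huv hux :=
    sep_VWin_of_sepInf hlip ((P.Zone_sepInf_FarNS huv hux δ').mono subset_rfl (Finset.coe_subset.2 (P.FarNS₂_subset_FarNS _ _))) _ _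

/-- **`QSepGeom`** over staggered cells (cells and zones of other macro-vertices against the cube), from (lip). [cite: KozmaNitzan2024, §4 p. 26 ((29))] -/
theorem qSepGeomSG₂T (hlip : Lip G ψ) : QSepGeom G (cellGeomSG₂T G ψ P w₀ Λ) where
  Cell_sep_Q _ _ _ _ hux := sep_VWin_of_sepInf hlip (P.Cell_sepInf_Q hux) _ _
  Zone_sep_Q _ _ u δ x _ := sep_VWin_of_sepInf hlip (P.Zone_sepInf_Q u δ x) _ _

end Records

end Skelφ

end Transplant

end Summit.CriticalPhenomena.PercolationContinuityZ3.Theorems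

end
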